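import Summits.AnomalousDissipation.AnomalousDissipation.Theorems.SawtoothPulseCascadeLipAgmonRecursion

/-!
# Phase bookkeeping of the line `lip-agmon`, part 2: the phase recursion
(route `AnomalousDissipation/SawtoothPulseCascade`, crux ApproxSol58 = stmt-AnomalousDissipation-19688;
lead g4, module F-arith part 2)

Sequel of `…LipAgmonRecursion` (monomial bookkeeping and the three slot-output bounds). Pure real
analysis: `phase_bounds` iterates the two unipotent slot maps of a phase and closes the induction with
the constants `B_z = 2d₀/(σμ − 1)`, `B₁ = X₁/(σ²μ)`, `B₂ = X₂/(σR_W)` (the transport factors `1`,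
`(1+γ)²`, `(1+γ+γ²)²` are STRICTLY below the ratios `σμ`, `R_W = σ²μ + (1+γ)²`,
`R_V = σR_W + (1+γ+γ²)²` by exactly the production parts, so no margin parameter is needed).
-/

set_option linter.dupNamespace false

noncomputable section

namespace Summit.AnomalousDissipation.AnomalousDissipation.Theorems.SawtoothPulseCascade.LipAgmon

open Finset

/-! ## The phase recursion -/

section Phase

/-- **Geometric bounds along the cascade from the unipotent slot maps.** Parameters: strain `γ ≥ 0`,
envelope constant `K ≥ 0` and ratio `μ`, scale ratio `σ ≥ 1` with `σ ≤ μ` and `σμ > 1`, base scale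
`s₀ ≥ 0`, caps `c₂, …, c₅ ≥ 0`. There are constants `B_z, B₁, B₂ ≥ 0` (independent of `ν`) such that for
every `ν ∈ (0, 1]` and all nonnegative sequences `z, S₁, S₂` (phase-start sizes of levels 0, 1, 2, zero at
`j = 0`) and `m₀, m₁, m₂` (mid-phase sizes) linked by the two slot maps of phase `j` (scale `s_j = s₀σ^j`,
envelope `e_j = Kν(j+1)μ^{j+1}`; level 0: `+γs(c₂e + c₃νs)`; level 1: `×(1+γ)` plus
`γ(1+γ)c₂sZ⁺ + γ(c₃s²e + c₂sZ⁺ + c₄νs³)`; level 2: `×(1+γ+γ²)` on `a₂ +` productions, `+ γc₂s(a₁ + γc₂sZ⁺)`),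
the sizes are geometric: `z_j ≤ B_z ν(j+1)(σμ)^j`, `S₁,j ≤ B₁ ν(j+1)R_W^j`, `S₂,j ≤ B₂ ν(j+1)R_V^j` with
`R_W = σ²μ + (1+γ)²`, `R_V = σR_W + (1+γ+γ²)²`, and the same for the mid-phase sizes with one extra factor
of the ratio. [folklore] -/
theorem phase_bounds {γ K μ σ s₀ c₂ c₃ c₄ c₅ : ℝ} (hγ : 0 ≤ γ) (hK : 0 ≤ K) (hσ : 1 ≤ σ) (hσμ : σ ≤ μ)
    (hσμ1 : 1 < σ * μ) (hs₀ : 0 ≤ s₀) (hc₂ : 0 ≤ c₂) (hc₃ : 0 ≤ c₃) (hc₄ : 0 ≤ c₄) (hc₅ : 0 ≤ c₅) :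
    ∃ Bz B₁ B₂ : ℝ, 0 ≤ Bz ∧ 0 ≤ B₁ ∧ 0 ≤ B₂ ∧
    ∀ (ν : ℝ), 0 < ν → ν ≤ 1 →
    ∀ (z S₁ S₂ m₀ m₁ m₂ : ℕ → ℝ),
      z 0 = 0 → S₁ 0 = 0 → S₂ 0 = 0 →
      (∀ j, 0 ≤ z j ∧ 0 ≤ S₁ j ∧ 0 ≤ S₂ j ∧ 0 ≤ m₀ j ∧ 0 ≤ m₁ j ∧ 0 ≤ m₂ j) →
      -- level 0, both slots
      (∀ j : ℕ, m₀ j ≤ z j + γ * (s₀ * σ ^ j) * (c₂ * (K * ν * ((j : ℝ) + 1) * μ ^ (j + 1)) + c₃ * ν * (s₀ * σ ^ j)) ∧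
        z (j + 1) ≤ m₀ j + γ * (s₀ * σ ^ j) * (c₂ * (K * ν * ((j : ℝ) + 1) * μ ^ (j + 1)) + c₃ * ν * (s₀ * σ ^ j))) →
      -- level 1, both slots (`Z⁺` = the slot's own level-0 output)
      (∀ j : ℕ,
        m₁ j ≤ (1 + γ) * S₁ j +
          γ * (1 + γ) * c₂ * (s₀ * σ ^ j) *
            (z j + γ * (s₀ * σ ^ j) * (c₂ * (K * ν * ((j : ℝ) + 1) * μ ^ (j + 1)) + c₃ * ν * (s₀ * σ ^ j))) +
          γ * (c₃ * (s₀ * σ ^ j) ^ 2 * (K * ν * ((j : ℝ) + 1) * μ ^ (j + 1)) +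
            c₂ * (s₀ * σ ^ j) *
              (z j + γ * (s₀ * σ ^ j) * (c₂ * (K * ν * ((j : ℝ) + 1) * μ ^ (j + 1)) + c₃ * ν * (s₀ * σ ^ j))) +
            c₄ * ν * (s₀ * σ ^ j) ^ 3) ∧
        S₁ (j + 1) ≤ (1 + γ) * m₁ j +
          γ * (1 + γ) * c₂ * (s₀ * σ ^ j) *
            (m₀ j + γ * (s₀ * σ ^ j) * (c₂ * (K * ν * ((j : ℝ) + 1) * μ ^ (j + 1)) + c₃ * ν * (s₀ * σ ^ j))) +
          γ * (c₃ * (s₀ * σ ^ j) ^ 2 * (K * ν * ((j : ℝ) + 1) * μ ^ (j + 1)) +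
            c₂ * (s₀ * σ ^ j) *
              (m₀ j + γ * (s₀ * σ ^ j) * (c₂ * (K * ν * ((j : ℝ) + 1) * μ ^ (j + 1)) + c₃ * ν * (s₀ * σ ^ j))) +
            c₄ * ν * (s₀ * σ ^ j) ^ 3)) →
      -- level 2, both slots (`S⁺` = the slot's own level-1 output, `a₁` its level-1 input)
      (∀ j : ℕ, ∀ (Zp Sp Zp' Sp' : ℝ),
        Zp = z j + γ * (s₀ * σ ^ j) * (c₂ * (K * ν * ((j : ℝ) + 1) * μ ^ (j + 1)) + c₃ * ν * (s₀ * σ ^ j)) →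
        Sp = (1 + γ) * S₁ j + γ * (1 + γ) * c₂ * (s₀ * σ ^ j) * Zp +
          γ * (c₃ * (s₀ * σ ^ j) ^ 2 * (K * ν * ((j : ℝ) + 1) * μ ^ (j + 1)) + c₂ * (s₀ * σ ^ j) * Zp +
            c₄ * ν * (s₀ * σ ^ j) ^ 3) →
        Zp' = m₀ j + γ * (s₀ * σ ^ j) * (c₂ * (K * ν * ((j : ℝ) + 1) * μ ^ (j + 1)) + c₃ * ν * (s₀ * σ ^ j)) →
        Sp' = (1 + γ) * m₁ j + γ * (1 + γ) * c₂ * (s₀ * σ ^ j) * Zp' +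
          γ * (c₃ * (s₀ * σ ^ j) ^ 2 * (K * ν * ((j : ℝ) + 1) * μ ^ (j + 1)) + c₂ * (s₀ * σ ^ j) * Zp' +
            c₄ * ν * (s₀ * σ ^ j) ^ 3) →
        m₂ j ≤ (1 + γ + γ ^ 2) * (S₂ j + γ * c₂ * (s₀ * σ ^ j) * Sp +
            γ * (c₃ * (s₀ * σ ^ j) ^ 2 * Zp + c₂ * (s₀ * σ ^ j) * Sp) +
            γ * (c₄ * (s₀ * σ ^ j) ^ 3 * (K * ν * ((j : ℝ) + 1) * μ ^ (j + 1)) + 2 * c₃ * (s₀ * σ ^ j) ^ 2 * Zp +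
              c₂ * (s₀ * σ ^ j) * Sp + c₅ * ν * (s₀ * σ ^ j) ^ 4)) +
          γ * c₂ * (s₀ * σ ^ j) * (S₁ j + γ * c₂ * (s₀ * σ ^ j) * Zp) ∧
        S₂ (j + 1) ≤ (1 + γ + γ ^ 2) * (m₂ j + γ * c₂ * (s₀ * σ ^ j) * Sp' +
            γ * (c₃ * (s₀ * σ ^ j) ^ 2 * Zp' + c₂ * (s₀ * σ ^ j) * Sp') +
            γ * (c₄ * (s₀ * σ ^ j) ^ 3 * (K * ν * ((j : ℝ) + 1) * μ ^ (j + 1)) + 2 * c₃ * (s₀ * σ ^ j) ^ 2 * Zp' +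
              c₂ * (s₀ * σ ^ j) * Sp' + c₅ * ν * (s₀ * σ ^ j) ^ 4)) +
          γ * c₂ * (s₀ * σ ^ j) * (m₁ j + γ * c₂ * (s₀ * σ ^ j) * Zp')) →
      ∀ j : ℕ,
        -- phase-start sizes
        (z j ≤ Bz * (ν * ((j : ℝ) + 1)) * (σ * μ) ^ j ∧
          S₁ j ≤ B₁ * (ν * ((j : ℝ) + 1)) * (σ ^ 2 * μ + (1 + γ) ^ 2) ^ j ∧
          S₂ j ≤ B₂ * (ν * ((j : ℝ) + 1)) * (σ * (σ ^ 2 * μ + (1 + γ) ^ 2) + (1 + γ + γ ^ 2) ^ 2) ^ j) ∧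
        -- the H-slot outputs (bounds for everything in the first half of phase `j`, and for the mid sizes)
        (∀ (Zp Sp : ℝ),
          Zp = z j + γ * (s₀ * σ ^ j) * (c₂ * (K * ν * ((j : ℝ) + 1) * μ ^ (j + 1)) + c₃ * ν * (s₀ * σ ^ j)) →
          Sp = (1 + γ) * S₁ j + γ * (1 + γ) * c₂ * (s₀ * σ ^ j) * Zp +
            γ * (c₃ * (s₀ * σ ^ j) ^ 2 * (K * ν * ((j : ℝ) + 1) * μ ^ (j + 1)) + c₂ * (s₀ * σ ^ j) * Zp +
              c₄ * ν * (s₀ * σ ^ j) ^ 3) →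
          Zp ≤ Bz * (ν * ((j : ℝ) + 1)) * (σ * μ) ^ (j + 1) ∧
          Sp ≤ B₁ * (ν * ((j : ℝ) + 1)) * (σ ^ 2 * μ + (1 + γ) ^ 2) ^ (j + 1) ∧
          (1 + γ + γ ^ 2) * (S₂ j + γ * c₂ * (s₀ * σ ^ j) * Sp +
              γ * (c₃ * (s₀ * σ ^ j) ^ 2 * Zp + c₂ * (s₀ * σ ^ j) * Sp) +
              γ * (c₄ * (s₀ * σ ^ j) ^ 3 * (K * ν * ((j : ℝ) + 1) * μ ^ (j + 1)) + 2 * c₃ * (s₀ * σ ^ j) ^ 2 * Zp +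
                c₂ * (s₀ * σ ^ j) * Sp + c₅ * ν * (s₀ * σ ^ j) ^ 4)) +
            γ * c₂ * (s₀ * σ ^ j) * (S₁ j + γ * c₂ * (s₀ * σ ^ j) * Zp) ≤
            B₂ * (ν * ((j : ℝ) + 1)) * (σ * (σ ^ 2 * μ + (1 + γ) ^ 2) + (1 + γ + γ ^ 2) ^ 2) ^ (j + 1)) ∧
        -- the V-slot outputs (bounds for everything in the second half of phase `j`, and for the next start)
        (∀ (Zp' Sp' : ℝ),
          Zp' = m₀ j + γ * (s₀ * σ ^ j) * (c₂ * (K * ν * ((j : ℝ) + 1) * μ ^ (j + 1)) + c₃ * ν * (s₀ * σ ^ j)) →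
          Sp' = (1 + γ) * m₁ j + γ * (1 + γ) * c₂ * (s₀ * σ ^ j) * Zp' +
            γ * (c₃ * (s₀ * σ ^ j) ^ 2 * (K * ν * ((j : ℝ) + 1) * μ ^ (j + 1)) + c₂ * (s₀ * σ ^ j) * Zp' +
              c₄ * ν * (s₀ * σ ^ j) ^ 3) →
          Zp' ≤ Bz * (ν * ((j : ℝ) + 1)) * (σ * μ) ^ (j + 1) ∧
          Sp' ≤ B₁ * (ν * ((j : ℝ) + 1)) * (σ ^ 2 * μ + (1 + γ) ^ 2) ^ (j + 1) ∧
          (1 + γ + γ ^ 2) * (m₂ j + γ * c₂ * (s₀ * σ ^ j) * Sp' +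
              γ * (c₃ * (s₀ * σ ^ j) ^ 2 * Zp' + c₂ * (s₀ * σ ^ j) * Sp') +
              γ * (c₄ * (s₀ * σ ^ j) ^ 3 * (K * ν * ((j : ℝ) + 1) * μ ^ (j + 1)) + 2 * c₃ * (s₀ * σ ^ j) ^ 2 * Zp' +
                c₂ * (s₀ * σ ^ j) * Sp' + c₅ * ν * (s₀ * σ ^ j) ^ 4)) +
            γ * c₂ * (s₀ * σ ^ j) * (m₁ j + γ * c₂ * (s₀ * σ ^ j) * Zp') ≤
            B₂ * (ν * ((j : ℝ) + 1)) * (σ * (σ ^ 2 * μ + (1 + γ) ^ 2) + (1 + γ + γ ^ 2) ^ 2) ^ (j + 1)) := by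
  have hσ0 : 0 ≤ σ := zero_le_one.trans hσ
  have hμ0 : 0 ≤ μ := hσ0.trans hσμ
  -- the ratios (opaque names)
  obtain ⟨RZ, hRZ⟩ : ∃ x : ℝ, x = σ * μ := ⟨_, rfl⟩
  obtain ⟨RW, hRW⟩ : ∃ x : ℝ, x = σ ^ 2 * μ + (1 + γ) ^ 2 := ⟨_, rfl⟩
  obtain ⟨RV, hRV⟩ : ∃ x : ℝ, x = σ * (σ ^ 2 * μ + (1 + γ) ^ 2) + (1 + γ + γ ^ 2) ^ 2 := ⟨_, rfl⟩
  have hRV' : RV = σ * RW + (1 + γ + γ ^ 2) ^ 2 := by rw [hRV, hRW]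
  have hRZ1 : 0 < RZ - 1 := by rw [hRZ]; linarith
  have hRZ0 : 0 ≤ RZ := by rw [hRZ]; positivity
  have hRW0 : 0 < σ ^ 2 * μ := by
    have : 1 ≤ σ ^ 2 * μ := by nlinarith
    linarith
  have hRWpos : 0 ≤ RW := by rw [hRW]; positivity
  have hσRW : 0 < σ * RW := by rw [hRW]; positivity
  have hRVpos : 0 ≤ RV := by rw [hRV]; positivity
  -- the constants (opaque names with defining equations)
  obtain ⟨d₀, hd₀⟩ : ∃ x : ℝ, x = γ * (c₂ * (s₀ * K * μ) + c₃ * s₀ ^ 2) := ⟨_, rfl⟩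
  have hd₀0 : 0 ≤ d₀ := by rw [hd₀]; positivity
  obtain ⟨Bz, hBz⟩ : ∃ x : ℝ, x = 2 * d₀ / (RZ - 1) := ⟨_, rfl⟩
  have hBz0 : 0 ≤ Bz := by rw [hBz]; positivity
  obtain ⟨Z1, hZ1⟩ : ∃ x : ℝ, x = Bz + d₀ := ⟨_, rfl⟩
  obtain ⟨Z2, hZ2⟩ : ∃ x : ℝ, x = Z1 + d₀ := ⟨_, rfl⟩
  have hZ10 : 0 ≤ Z1 := by rw [hZ1]; positivity
  have hZ20 : 0 ≤ Z2 := by rw [hZ2]; positivity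
  have eZ2 : Z2 = Bz * RZ := by
    rw [hZ2, hZ1, hBz]; field_simp; ring
  -- level 1
  have G₁def : ∀ Z : ℝ, ∃ G : ℝ, G = γ * (1 + γ) * c₂ * s₀ * Z + γ * (c₃ * (s₀ ^ 2 * K * μ) + c₂ * s₀ * Z + c₄ * s₀ ^ 3) :=
    fun Z => ⟨_, rfl⟩
  obtain ⟨G1, hG1⟩ := G₁def Z1
  obtain ⟨G2, hG2⟩ := G₁def Z2
  have hG10 : 0 ≤ G1 := by rw [hG1]; positivity
  have hG20 : 0 ≤ G2 := by rw [hG2]; positivity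
  obtain ⟨X₁, hX₁⟩ : ∃ x : ℝ, x = (1 + γ) * G1 + G2 := ⟨_, rfl⟩
  have hX₁0 : 0 ≤ X₁ := by rw [hX₁]; positivity
  obtain ⟨B₁, hB₁⟩ : ∃ x : ℝ, x = X₁ / (σ ^ 2 * μ) := ⟨_, rfl⟩
  have hB₁0 : 0 ≤ B₁ := by rw [hB₁]; positivity
  obtain ⟨C₁, hC₁⟩ : ∃ x : ℝ, x = (1 + γ) * B₁ + G1 := ⟨_, rfl⟩
  obtain ⟨C₁', hC₁'⟩ : ∃ x : ℝ, x = (1 + γ) * C₁ + G2 := ⟨_, rfl⟩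
  have hC₁0 : 0 ≤ C₁ := by rw [hC₁]; positivity
  have eC₁' : C₁' = B₁ * RW := by
    have h : B₁ * (σ ^ 2 * μ) = X₁ := by rw [hB₁]; exact div_mul_cancel₀ X₁ hRW0.ne'
    rw [hC₁', hC₁, hRW]
    linear_combination -h - hX₁
  have hC₁le : C₁ ≤ C₁' := by
    have h5 : 0 ≤ γ * C₁ + G2 := by positivity
    rw [hC₁']; linarith only [h5]
  -- level 2
  have F₂def : ∀ A₂ A₁ Z Sb : ℝ, ∃ F : ℝ, F = (1 + γ + γ ^ 2) * (A₂ + γ * c₂ * s₀ * Sb +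
      γ * (c₃ * s₀ ^ 2 * Z + c₂ * s₀ * Sb) + γ * (c₄ * (s₀ ^ 3 * K * μ) + 2 * c₃ * s₀ ^ 2 * Z + c₂ * s₀ * Sb +
        c₅ * s₀ ^ 4)) + γ * c₂ * (s₀ * A₁ + γ * c₂ * s₀ ^ 2 * Z) := fun _ _ _ _ => ⟨_, rfl⟩
  obtain ⟨Y1, hY1⟩ := F₂def 0 B₁ Z1 C₁
  obtain ⟨Y2, hY2⟩ := F₂def 0 C₁ Z2 C₁'
  have hC₁'0 : 0 ≤ C₁' := hC₁0.trans hC₁le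
  have hY10 : 0 ≤ Y1 := by rw [hY1]; positivity
  have hY20 : 0 ≤ Y2 := by rw [hY2]; positivity
  obtain ⟨X₂, hX₂⟩ : ∃ x : ℝ, x = (1 + γ + γ ^ 2) * Y1 + Y2 := ⟨_, rfl⟩
  have hX₂0 : 0 ≤ X₂ := by rw [hX₂]; positivity
  obtain ⟨B₂, hB₂⟩ : ∃ x : ℝ, x = X₂ / (σ * RW) := ⟨_, rfl⟩
  have hB₂0 : 0 ≤ B₂ := by rw [hB₂]; positivity
  obtain ⟨C₂, hC₂⟩ : ∃ x : ℝ, x = (1 + γ + γ ^ 2) * B₂ + Y1 := ⟨_, rfl⟩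
  obtain ⟨C₂', hC₂'⟩ : ∃ x : ℝ, x = (1 + γ + γ ^ 2) * C₂ + Y2 := ⟨_, rfl⟩
  have hT1 : 0 ≤ 1 + γ + γ ^ 2 := by positivity
  have hC₂0 : 0 ≤ C₂ := by rw [hC₂]; positivity
  have eC₂' : C₂' = B₂ * RV := by
    have h : B₂ * (σ * RW) = X₂ := by rw [hB₂]; exact div_mul_cancel₀ X₂ hσRW.ne'
    rw [hC₂', hC₂, hRV']
    linear_combination -h - hX₂
  have hC₂le : C₂ ≤ C₂' := by
    have h5 : 0 ≤ (γ + γ ^ 2) * C₂ + Y2 := by positivity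
    rw [hC₂']; linarith only [h5]
  refine ⟨Bz, B₁, B₂, hBz0, hB₁0, hB₂0, ?_⟩
  intro ν hν hν1 z S₁ S₂ m₀ m₁ m₂ hz0 h10 h20 hnn hst0 hst1 hst2
  -- the step: from the phase-start bounds at `j`, the outputs of both slots at `j`
  have step : ∀ j : ℕ, (z j ≤ Bz * (ν * ((j : ℝ) + 1)) * RZ ^ j ∧
      S₁ j ≤ B₁ * (ν * ((j : ℝ) + 1)) * RW ^ j ∧ S₂ j ≤ B₂ * (ν * ((j : ℝ) + 1)) * RV ^ j) →
      ∀ (Zp Sp Zp' Sp' : ℝ),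
        Zp = z j + γ * (s₀ * σ ^ j) * (c₂ * (K * ν * ((j : ℝ) + 1) * μ ^ (j + 1)) + c₃ * ν * (s₀ * σ ^ j)) →
        Sp = (1 + γ) * S₁ j + γ * (1 + γ) * c₂ * (s₀ * σ ^ j) * Zp +
          γ * (c₃ * (s₀ * σ ^ j) ^ 2 * (K * ν * ((j : ℝ) + 1) * μ ^ (j + 1)) + c₂ * (s₀ * σ ^ j) * Zp +
            c₄ * ν * (s₀ * σ ^ j) ^ 3) →
        Zp' = m₀ j + γ * (s₀ * σ ^ j) * (c₂ * (K * ν * ((j : ℝ) + 1) * μ ^ (j + 1)) + c₃ * ν * (s₀ * σ ^ j)) →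
        Sp' = (1 + γ) * m₁ j + γ * (1 + γ) * c₂ * (s₀ * σ ^ j) * Zp' +
          γ * (c₃ * (s₀ * σ ^ j) ^ 2 * (K * ν * ((j : ℝ) + 1) * μ ^ (j + 1)) + c₂ * (s₀ * σ ^ j) * Zp' +
            c₄ * ν * (s₀ * σ ^ j) ^ 3) →
      (Zp ≤ Z1 * (ν * ((j : ℝ) + 1)) * RZ ^ j ∧ Sp ≤ C₁ * (ν * ((j : ℝ) + 1)) * RW ^ j ∧
        (1 + γ + γ ^ 2) * (S₂ j + γ * c₂ * (s₀ * σ ^ j) * Sp +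
            γ * (c₃ * (s₀ * σ ^ j) ^ 2 * Zp + c₂ * (s₀ * σ ^ j) * Sp) +
            γ * (c₄ * (s₀ * σ ^ j) ^ 3 * (K * ν * ((j : ℝ) + 1) * μ ^ (j + 1)) + 2 * c₃ * (s₀ * σ ^ j) ^ 2 * Zp +
              c₂ * (s₀ * σ ^ j) * Sp + c₅ * ν * (s₀ * σ ^ j) ^ 4)) +
          γ * c₂ * (s₀ * σ ^ j) * (S₁ j + γ * c₂ * (s₀ * σ ^ j) * Zp) ≤ C₂ * (ν * ((j : ℝ) + 1)) * RV ^ j) ∧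
      (Zp' ≤ Z2 * (ν * ((j : ℝ) + 1)) * RZ ^ j ∧ Sp' ≤ C₁' * (ν * ((j : ℝ) + 1)) * RW ^ j ∧
        (1 + γ + γ ^ 2) * (m₂ j + γ * c₂ * (s₀ * σ ^ j) * Sp' +
            γ * (c₃ * (s₀ * σ ^ j) ^ 2 * Zp' + c₂ * (s₀ * σ ^ j) * Sp') +
            γ * (c₄ * (s₀ * σ ^ j) ^ 3 * (K * ν * ((j : ℝ) + 1) * μ ^ (j + 1)) + 2 * c₃ * (s₀ * σ ^ j) ^ 2 * Zp' +
              c₂ * (s₀ * σ ^ j) * Sp' + c₅ * ν * (s₀ * σ ^ j) ^ 4)) +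
          γ * c₂ * (s₀ * σ ^ j) * (m₁ j + γ * c₂ * (s₀ * σ ^ j) * Zp') ≤ C₂' * (ν * ((j : ℝ) + 1)) * RV ^ j) := by
    intro j ⟨hzj, h1j, h2j⟩ Zp Sp Zp' Sp' eZp eSp eZp' eSp'
    obtain ⟨hm0, hz1⟩ := hst0 j
    obtain ⟨hm1, hs1⟩ := hst1 j
    obtain ⟨hm2, hs2⟩ := hst2 j Zp Sp Zp' Sp' eZp eSp eZp' eSp'
    rw [hRZ] at hzj
    rw [hRW] at h1j
    rw [hRV] at h2j
    -- slot 1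
    have a0 := slot_zero_bound (K := K) (c₂ := c₂) hγ hσ hσμ hs₀ hc₃ hν.le hzj
    have eZ1c : Bz + γ * (c₂ * (s₀ * K * μ) + c₃ * s₀ ^ 2) = Z1 := by rw [hZ1, hd₀]
    rw [eZ1c] at a0
    have a0v : Zp ≤ Z1 * (ν * ((j : ℝ) + 1)) * (σ * μ) ^ j := by rw [eZp]; exact a0
    have a1 := slot_one_bound (c₄ := c₄) hγ hK hσ hσμ hs₀ hc₂ hc₃ hc₄ hν.le hZ10 h1j a0
    have eC₁c : (1 + γ) * B₁ + γ * (1 + γ) * c₂ * s₀ * Z1 +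
        γ * (c₃ * (s₀ ^ 2 * K * μ) + c₂ * s₀ * Z1 + c₄ * s₀ ^ 3) = C₁ := by rw [hC₁, hG1]; ring
    rw [eC₁c] at a1
    have a1v : Sp ≤ C₁ * (ν * ((j : ℝ) + 1)) * (σ ^ 2 * μ + (1 + γ) ^ 2) ^ j := by rw [eSp, eZp]; exact a1
    have a2 := slot_two_bound (c₅ := c₅) hγ hK hσ hσμ hs₀ hc₂ hc₃ hc₄ hc₅ hν.le hB₁0 hZ10 hC₁0 h2j h1j a0v a1v
    have eC₂c : (1 + γ + γ ^ 2) * (B₂ + γ * c₂ * s₀ * C₁ + γ * (c₃ * s₀ ^ 2 * Z1 + c₂ * s₀ * C₁) +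
        γ * (c₄ * (s₀ ^ 3 * K * μ) + 2 * c₃ * s₀ ^ 2 * Z1 + c₂ * s₀ * C₁ + c₅ * s₀ ^ 4)) +
        γ * c₂ * (s₀ * B₁ + γ * c₂ * s₀ ^ 2 * Z1) = C₂ := by rw [hC₂, hY1]; ring
    rw [eC₂c] at a2
    -- the mid sizes
    have hm0' : m₀ j ≤ Z1 * (ν * ((j : ℝ) + 1)) * (σ * μ) ^ j := hm0.trans a0
    have hm1' : m₁ j ≤ C₁ * (ν * ((j : ℝ) + 1)) * (σ ^ 2 * μ + (1 + γ) ^ 2) ^ j := hm1.trans a1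
    have hm2' : m₂ j ≤ C₂ * (ν * ((j : ℝ) + 1)) * (σ * (σ ^ 2 * μ + (1 + γ) ^ 2) + (1 + γ + γ ^ 2) ^ 2) ^ j :=
      hm2.trans a2
    -- slot 2
    have b0 := slot_zero_bound (K := K) (c₂ := c₂) hγ hσ hσμ hs₀ hc₃ hν.le hm0'
    have eZ2c : Z1 + γ * (c₂ * (s₀ * K * μ) + c₃ * s₀ ^ 2) = Z2 := by rw [hZ2, hd₀]
    rw [eZ2c] at b0
    have b0v : Zp' ≤ Z2 * (ν * ((j : ℝ) + 1)) * (σ * μ) ^ j := by rw [eZp']; exact b0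
    have b1 := slot_one_bound (c₄ := c₄) hγ hK hσ hσμ hs₀ hc₂ hc₃ hc₄ hν.le hZ20 hm1' b0
    have eC₁'c : (1 + γ) * C₁ + γ * (1 + γ) * c₂ * s₀ * Z2 +
        γ * (c₃ * (s₀ ^ 2 * K * μ) + c₂ * s₀ * Z2 + c₄ * s₀ ^ 3) = C₁' := by rw [hC₁', hG2]; ring
    rw [eC₁'c] at b1
    have b1v : Sp' ≤ C₁' * (ν * ((j : ℝ) + 1)) * (σ ^ 2 * μ + (1 + γ) ^ 2) ^ j := by rw [eSp', eZp']; exact b1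
    have b2 := slot_two_bound (c₅ := c₅) hγ hK hσ hσμ hs₀ hc₂ hc₃ hc₄ hc₅ hν.le hC₁0 hZ20 hC₁'0 hm2' hm1' b0v b1v
    have eC₂'c : (1 + γ + γ ^ 2) * (C₂ + γ * c₂ * s₀ * C₁' + γ * (c₃ * s₀ ^ 2 * Z2 + c₂ * s₀ * C₁') +
        γ * (c₄ * (s₀ ^ 3 * K * μ) + 2 * c₃ * s₀ ^ 2 * Z2 + c₂ * s₀ * C₁' + c₅ * s₀ ^ 4)) +
        γ * c₂ * (s₀ * C₁ + γ * c₂ * s₀ ^ 2 * Z2) = C₂' := by rw [hC₂', hY2]; ring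
    rw [eC₂'c] at b2
    rw [← hRZ] at a0v b0v
    rw [← hRW] at a1v b1v
    rw [← hRV] at a2 b2
    exact ⟨⟨a0v, a1v, a2⟩, ⟨b0v, b1v, b2⟩⟩
  -- the induction on the phase-start sizes
  have start : ∀ j : ℕ, z j ≤ Bz * (ν * ((j : ℝ) + 1)) * RZ ^ j ∧
      S₁ j ≤ B₁ * (ν * ((j : ℝ) + 1)) * RW ^ j ∧ S₂ j ≤ B₂ * (ν * ((j : ℝ) + 1)) * RV ^ j := by
    intro j
    induction j with
    | zero =>
      simp only [Nat.cast_zero, zero_add, mul_one, pow_zero]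
      rw [hz0, h10, h20]
      exact ⟨by positivity, by positivity, by positivity⟩
    | succ j ih =>
      obtain ⟨-, hz1', hs1', hs2'⟩ := step j ih _ _ _ _ rfl rfl rfl rfl
      have hz1 := (hst0 j).2.trans hz1'
      have hs1 := (hst1 j).2.trans hs1'
      have hs2 := ((hst2 j _ _ _ _ rfl rfl rfl rfl).2).trans hs2'
      have hu : ν * ((j : ℝ) + 1) ≤ ν * (((j + 1 : ℕ) : ℝ) + 1) := by
        push_cast
        exact mul_le_mul_of_nonneg_left (by linarith only) hν.le
      have hu0 : 0 ≤ ν * ((j : ℝ) + 1) := mul_nonneg hν.le (by positivity)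
      refine ⟨?_, ?_, ?_⟩
      · rw [eZ2] at hz1
        calc z (j + 1) ≤ Bz * RZ * (ν * ((j : ℝ) + 1)) * RZ ^ j := hz1
          _ = Bz * (ν * ((j : ℝ) + 1)) * RZ ^ (j + 1) := by ring
          _ ≤ Bz * (ν * (((j + 1 : ℕ) : ℝ) + 1)) * RZ ^ (j + 1) := by
              have := pow_nonneg hRZ0 (j + 1)
              gcongr
      · rw [eC₁'] at hs1
        calc S₁ (j + 1) ≤ B₁ * RW * (ν * ((j : ℝ) + 1)) * RW ^ j := hs1
          _ = B₁ * (ν * ((j : ℝ) + 1)) * RW ^ (j + 1) := by ring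
          _ ≤ B₁ * (ν * (((j + 1 : ℕ) : ℝ) + 1)) * RW ^ (j + 1) := by
              have := pow_nonneg hRWpos (j + 1)
              gcongr
      · rw [eC₂'] at hs2
        calc S₂ (j + 1) ≤ B₂ * RV * (ν * ((j : ℝ) + 1)) * RV ^ j := hs2
          _ = B₂ * (ν * ((j : ℝ) + 1)) * RV ^ (j + 1) := by ring
          _ ≤ B₂ * (ν * (((j + 1 : ℕ) : ℝ) + 1)) * RV ^ (j + 1) := by
              have := pow_nonneg hRVpos (j + 1)
              gcongr
  -- read off the statement
  intro j
  obtain ⟨hzj, h1j, h2j⟩ := start j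
  have hu0 : 0 ≤ ν * ((j : ℝ) + 1) := mul_nonneg hν.le (by positivity)
  have hRZj : 0 ≤ RZ ^ j := pow_nonneg hRZ0 j
  have hRWj : 0 ≤ RW ^ j := pow_nonneg hRWpos j
  have hRVj : 0 ≤ RV ^ j := pow_nonneg hRVpos j
  have hZ1le : Z1 ≤ Bz * RZ := by rw [← eZ2, hZ2]; linarith only [hd₀0]
  have hC₁le' : C₁ ≤ B₁ * RW := by rw [← eC₁']; exact hC₁le
  have hC₂le' : C₂ ≤ B₂ * RV := by rw [← eC₂']; exact hC₂le
  have k0 : Z1 * (ν * ((j : ℝ) + 1)) * RZ ^ j ≤ Bz * (ν * ((j : ℝ) + 1)) * RZ ^ (j + 1) := by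
    calc Z1 * (ν * ((j : ℝ) + 1)) * RZ ^ j ≤ Bz * RZ * (ν * ((j : ℝ) + 1)) * RZ ^ j := by gcongr
      _ = Bz * (ν * ((j : ℝ) + 1)) * RZ ^ (j + 1) := by ring
  have k1 : C₁ * (ν * ((j : ℝ) + 1)) * RW ^ j ≤ B₁ * (ν * ((j : ℝ) + 1)) * RW ^ (j + 1) := by
    calc C₁ * (ν * ((j : ℝ) + 1)) * RW ^ j ≤ B₁ * RW * (ν * ((j : ℝ) + 1)) * RW ^ j := by gcongr
      _ = B₁ * (ν * ((j : ℝ) + 1)) * RW ^ (j + 1) := by ring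
  have k2 : C₂ * (ν * ((j : ℝ) + 1)) * RV ^ j ≤ B₂ * (ν * ((j : ℝ) + 1)) * RV ^ (j + 1) := by
    calc C₂ * (ν * ((j : ℝ) + 1)) * RV ^ j ≤ B₂ * RV * (ν * ((j : ℝ) + 1)) * RV ^ j := by gcongr
      _ = B₂ * (ν * ((j : ℝ) + 1)) * RV ^ (j + 1) := by ring
  have e0 : Z2 * (ν * ((j : ℝ) + 1)) * RZ ^ j = Bz * (ν * ((j : ℝ) + 1)) * RZ ^ (j + 1) := by rw [eZ2]; ring
  have e1 : C₁' * (ν * ((j : ℝ) + 1)) * RW ^ j = B₁ * (ν * ((j : ℝ) + 1)) * RW ^ (j + 1) := by rw [eC₁']; ring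
  have e2 : C₂' * (ν * ((j : ℝ) + 1)) * RV ^ j = B₂ * (ν * ((j : ℝ) + 1)) * RV ^ (j + 1) := by rw [eC₂']; ring
  rw [← hRV, ← hRW, ← hRZ]
  refine ⟨⟨hzj, h1j, h2j⟩, ?_, ?_⟩
  · intro Zp Sp eZp eSp
    obtain ⟨⟨a0, a1, a2⟩, -⟩ := step j (start j) Zp Sp _ _ eZp eSp rfl rfl
    exact ⟨a0.trans k0, a1.trans k1, a2.trans k2⟩
  · intro Zp' Sp' eZp' eSp'
    obtain ⟨-, ⟨b0, b1, b2⟩⟩ := step j (start j) _ _ Zp' Sp' rfl rfl eZp' eSp'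
    exact ⟨e0 ▸ b0, e1 ▸ b1, e2 ▸ b2⟩

end Phase

end Summit.AnomalousDissipation.AnomalousDissipation.Theorems.SawtoothPulseCascade.LipAgmon

end
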